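import Mathlib.Analysis.SpecialFunctions.ImproperIntegrals
import Mathlib.Analysis.SpecialFunctions.Integrals.Basic
import Mathlib.MeasureTheory.Integral.IntegralEqImproper
import Mathlib.MeasureTheory.Integral.IntervalIntegral.FundThmCalculus
import HarnessLib

/-!
# The energy and momentum sectors of the Thales-sphere averaging operator: Volterra form,
# bounded inverse modulo the resonant mode, and Liouville theorems

Analysis/ODE support file (everything proved, no definitions).

**Kinetic background (not formalised here).** For the linearised hard-sphere Boltzmann operator
`L = -ν - K₁ + K₂` on `ℝ³` in the Maxwellian-weighted picture, the normalised gain part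
`P = ν⁻¹ K₂` acts at large velocities, to leading order, as the *Thales average*
`T ψ (v) = 2 ⨍_{S_v} ψ`, where `S_v` is the sphere with diameter `[0, v]`. On a radial profile
`ψ(v) = h(‖v‖)` and on a dipole profile `ψ(v) = h(‖v‖) ⟪e, v/‖v‖⟫` it acts on the radial factor by
`h ↦ 4 ∫₀¹ h(r t) t dt = (4/r²) ∫₀^r ρ h(ρ) dρ`, resp. `h ↦ 4 ∫₀¹ h(r t) t² dt = (4/r³) ∫₀^r ρ² h(ρ) dρ`
(Funk–Hecke with `P₀ = 1`, `P₁(t) = t`), so that the fixed-point equation `ψ = T ψ + f` becomes the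
Euler-type Volterra equations

`r² h(r) = 4 ∫₀^r ρ h(ρ) dρ + r² f(r)`  (energy sector, indicial root `α = 2`),
`r³ h(r) = 4 ∫₀^r ρ² h(ρ) dρ + r³ f(r)`  (momentum sector, indicial root `α = 1`).

**What is proved (pure one-variable calculus).**
* `exists_abs_sub_le_of_hasDerivAt_Ioi`: a tail lemma — if `G' = g` on `(0, ∞)` with
  `|g(r)| ≤ b m r^{-(m+1)}` (`m > 0`), then `G` has a limit `c` at `∞` and `|G(r) - c| ≤ b r^{-m}`.
* `exists_abs_sub_mul_sq_le_of_energyVolterra`: for continuous `h` and `|f| ≤ b` on `(0,∞)`, every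
  solution of the energy-sector equation satisfies `|h(r) - c r²| ≤ 3 b` for some constant `c`
  (variation of constants: `(F/r⁴)' = f/r³` for `F = ∫₀^r ρ h`);
  `exists_abs_sub_mul_le_of_momentumVolterra`: in the momentum sector `|h(r) - c r| ≤ 5 b`.
* Liouville corollaries (`f = 0`): `h = c r²`, resp. `h = c r`
  (`exists_eq_mul_sq_of_energyVolterra`, `exists_eq_mul_of_momentumVolterra`) — no growth
  hypothesis is needed because the equations are of Volterra type.

These are the two resonant sectors `(α, ℓ) = (2, 0), (1, 1)` of the symbol
`λ(α, ℓ) = 4 ∫₀¹ t^{α+1} P_ℓ(t) dt` of `T`; the constants `3 = 1 + 4·(1/2)` and `5 = 1 + 4·1` are the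
total variations of the resolvent measures `δ - 4 e^{-2s} 1_{s ≥ 0} ds`, `δ - 4 e^{-s} 1_{s ≥ 0} ds`
on the dilation group. **Not here:** the sectors `ℓ ≥ 2` (no resonance in `Re α ≥ 0`), the
uniform-in-`ℓ` (`L^∞`) theory, and the comparison `P - T` for the true linearised operator.
Standard calculus; folklore.
-/

noncomputable section

namespace Literature.Analysis.ODE

open MeasureTheory Set Filter Topology intervalIntegral

/-! ### A tail lemma on `(0, ∞)` -/

/-- **Tail lemma.** If `G` has derivative `g` at every point of `(0, ∞)`, `g` is continuous there and
`|g(r)| ≤ b m r^{-(m+1)}` with `m > 0`, then there is a constant `c` (the limit of `G` at `+∞`) with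
`|G(r) - c| ≤ b r^{-m}` for all `r > 0`. [folklore] -/
theorem exists_abs_sub_le_of_hasDerivAt_Ioi {G g : ℝ → ℝ} {b m : ℝ} (hm : 0 < m)
    (hg : ContinuousOn g (Ioi 0)) (hderiv : ∀ r, 0 < r → HasDerivAt G (g r) r)
    (hbound : ∀ r, 0 < r → |g r| ≤ b * m * r ^ (-(m + 1))) :
    ∃ c : ℝ, ∀ r, 0 < r → |G r - c| ≤ b * r ^ (-m) := by
  have hlt : -(m + 1) < -1 := by linarith
  -- `g` is integrable on every `(r, ∞)`, `r > 0`
  have hgi : ∀ r, 0 < r → IntegrableOn g (Ioi r) := by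
    intro r hr
    have hdom : IntegrableOn (fun s : ℝ => b * m * s ^ (-(m + 1))) (Ioi r) :=
      (integrableOn_Ioi_rpow_of_lt hlt hr).const_mul (b * m)
    refine hdom.mono' ((hg.mono fun s hs => hr.trans hs).aestronglyMeasurable measurableSet_Ioi) ?_
    refine (ae_restrict_iff' measurableSet_Ioi).2 (Eventually.of_forall fun s hs => ?_)
    rw [Real.norm_eq_abs]
    exact hbound s (hr.trans hs)
  -- fundamental theorem of calculus on `[r, R]`
  have hftc : ∀ r R, 0 < r → r ≤ R → ∫ s in r..R, g s = G R - G r := by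
    intro r R hr hrR
    refine integral_eq_sub_of_hasDerivAt (fun s hs => hderiv s ?_) ?_
    · rw [uIcc_of_le hrR] at hs
      exact hr.trans_le hs.1
    · exact (hg.mono fun s hs => hr.trans_le hs.1).intervalIntegrable_of_Icc hrR
  -- the quantity `G r + ∫_{(r, ∞)} g` does not depend on `r`
  have hconst : ∀ r, 0 < r → G r + ∫ s in Ioi r, g s = G 1 + ∫ s in Ioi 1, g s := by
    intro r hr
    have h1 : Tendsto (fun R => G r + ∫ s in r..R, g s) atTop (𝓝 (G r + ∫ s in Ioi r, g s)) :=
      tendsto_const_nhds.add (intervalIntegral_tendsto_integral_Ioi r (hgi r hr) tendsto_id)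
    have h2 : Tendsto (fun R => G 1 + ∫ s in (1 : ℝ)..R, g s) atTop
        (𝓝 (G 1 + ∫ s in Ioi 1, g s)) :=
      tendsto_const_nhds.add (intervalIntegral_tendsto_integral_Ioi 1 (hgi 1 one_pos) tendsto_id)
    have heq : (fun R => G r + ∫ s in r..R, g s) =ᶠ[atTop]
        fun R => G 1 + ∫ s in (1 : ℝ)..R, g s := by
      filter_upwards [eventually_ge_atTop (max r 1)] with R hR
      rw [hftc r R hr ((le_max_left _ _).trans hR), hftc 1 R one_pos ((le_max_right _ _).trans hR)]
      ring
    exact tendsto_nhds_unique (h1.congr' heq) h2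
  refine ⟨G 1 + ∫ s in Ioi 1, g s, fun r hr => ?_⟩
  have hsub : G r - (G 1 + ∫ s in Ioi 1, g s) = -∫ s in Ioi r, g s := by
    rw [← hconst r hr]
    ring
  rw [hsub, abs_neg]
  calc |∫ s in Ioi r, g s| ≤ ∫ s in Ioi r, |g s| := abs_integral_le_integral_abs
    _ ≤ ∫ s in Ioi r, b * m * s ^ (-(m + 1)) :=
        setIntegral_mono_on (hgi r hr).abs ((integrableOn_Ioi_rpow_of_lt hlt hr).const_mul _)
          measurableSet_Ioi fun s hs => hbound s (hr.trans hs)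
    _ = b * r ^ (-m) := by
        rw [MeasureTheory.integral_const_mul, integral_Ioi_rpow_of_lt hlt hr]
        have e : -(m + 1) + 1 = -m := by ring
        rw [e]
        field_simp

/-- For a real `r` and a natural number `n`, `r ^ (-(n : ℝ)) = (r ^ n)⁻¹` (real power with a
negative integer exponent; combines Mathlib's `Real.rpow_neg_natCast` with `zpow_neg`). [folklore] -/
theorem rpow_neg_natCast_eq_inv_pow (r : ℝ) (n : ℕ) : r ^ (-(n : ℝ)) = (r ^ n)⁻¹ := by
  rw [Real.rpow_neg_natCast, zpow_neg, zpow_natCast]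

/-! ### The energy sector `r² h = 4 ∫₀^r ρ h + r² f` -/

/-- **Energy sector of the Thales average, bounded inverse modulo `r²`.** Let `h` be continuous and
let `f` be bounded by `b` on `(0, ∞)`. If `r² h(r) = 4 ∫₀^r ρ h(ρ) dρ + r² f(r)` for all `r > 0`
(i.e. `h = T h + f` for the radial Thales average `T h (r) = 4 ∫₀¹ h(r t) t dt`), then there is a
constant `c` with `|h(r) - c r²| ≤ 3 b` for all `r > 0`. Proof: `F = ∫₀^r ρ h` satisfies
`(F / r⁴)' = f / r³`, so `F/r⁴` has a limit `c/4` with `|F/r⁴ - c/4| ≤ b/(2r²)`, and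
`h = 4F/r² + f`. [folklore] -/
theorem exists_abs_sub_mul_sq_le_of_energyVolterra {h f : ℝ → ℝ} {b : ℝ} (hh : Continuous h)
    (hb : ∀ r, 0 < r → |f r| ≤ b)
    (hfix : ∀ r, 0 < r → r ^ 2 * h r = 4 * (∫ ρ in (0 : ℝ)..r, ρ * h ρ) + r ^ 2 * f r) :
    ∃ c : ℝ, ∀ r, 0 < r → |h r - c * r ^ 2| ≤ 3 * b := by
  set F : ℝ → ℝ := fun r => ∫ ρ in (0 : ℝ)..r, ρ * h ρ with hF
  have hFd : ∀ r, HasDerivAt F (r * h r) r := fun r =>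
    ((continuous_id.mul hh).integral_hasStrictDerivAt 0 r).hasDerivAt
  have hFc : Continuous F := continuous_iff_continuousAt.2 fun r => (hFd r).continuousAt
  -- `f = h - 4 F / r²` on `(0, ∞)`, hence continuous there
  have hfeq : ∀ r, 0 < r → f r = h r - 4 * F r / r ^ 2 := by
    intro r hr
    have key := hfix r hr
    have hr2 : r ^ 2 ≠ 0 := pow_ne_zero 2 hr.ne'
    field_simp
    linarith
  have hfc : ContinuousOn f (Ioi 0) := by
    have : ContinuousOn (fun r => h r - 4 * F r / r ^ 2) (Ioi 0) :=
      hh.continuousOn.sub ((continuousOn_const.mul hFc.continuousOn).div (continuousOn_pow 2)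
        fun r hr => pow_ne_zero 2 (ne_of_gt hr))
    exact this.congr fun r hr => hfeq r hr
  -- `G = F / r⁴` has derivative `f / r³`
  set G : ℝ → ℝ := fun r => F r / r ^ 4 with hG
  have hGd : ∀ r, 0 < r → HasDerivAt G (f r / r ^ 3) r := by
    intro r hr
    have hr0 : r ≠ 0 := hr.ne'
    have e := (hFd r).div (hasDerivAt_pow 4 r) (pow_ne_zero 4 hr0)
    refine e.congr_deriv ?_
    have key := hfix r hr
    field_simp
    linear_combination (r ^ 3) * key
  have hgc : ContinuousOn (fun r => f r / r ^ 3) (Ioi 0) :=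
    hfc.div (continuousOn_pow 3) fun r hr => pow_ne_zero 3 (ne_of_gt hr)
  have hgb : ∀ r, 0 < r → |f r / r ^ 3| ≤ b / 2 * 2 * r ^ (-((2 : ℝ) + 1)) := by
    intro r hr
    rw [show (-((2 : ℝ) + 1)) = -((3 : ℕ) : ℝ) by norm_num, rpow_neg_natCast_eq_inv_pow r, abs_div,
      abs_of_pos (pow_pos hr 3), div_eq_mul_inv]
    have : b / 2 * 2 = b := by ring
    rw [this]
    exact mul_le_mul_of_nonneg_right (hb r hr) (inv_nonneg.2 (pow_pos hr 3).le)
  obtain ⟨c', hc'⟩ := exists_abs_sub_le_of_hasDerivAt_Ioi two_pos hgc hGd hgb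
  refine ⟨4 * c', fun r hr => ?_⟩
  have hr0 : r ≠ 0 := hr.ne'
  have hGr := hc' r hr
  rw [show (-(2 : ℝ)) = -((2 : ℕ) : ℝ) by norm_num, rpow_neg_natCast_eq_inv_pow r] at hGr
  -- `h - 4 c' r² = 4 r² (G - c') + f`
  have hdecomp : h r - 4 * c' * r ^ 2 = 4 * r ^ 2 * (G r - c') + f r := by
    rw [hfeq r hr, hG]
    field_simp
    ring
  rw [hdecomp]
  have h1 : |4 * r ^ 2 * (G r - c')| ≤ 2 * b := by
    rw [abs_mul, abs_of_pos (by positivity : (0 : ℝ) < 4 * r ^ 2)]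
    calc 4 * r ^ 2 * |G r - c'| ≤ 4 * r ^ 2 * (b / 2 * (r ^ 2)⁻¹) :=
          mul_le_mul_of_nonneg_left hGr (by positivity)
      _ = 2 * b := by field_simp; ring
  calc |4 * r ^ 2 * (G r - c') + f r| ≤ |4 * r ^ 2 * (G r - c')| + |f r| := abs_add_le _ _
    _ ≤ 2 * b + b := add_le_add h1 (hb r hr)
    _ = 3 * b := by ring

/-- **Liouville theorem in the energy sector.** A continuous `h` with
`r² h(r) = 4 ∫₀^r ρ h(ρ) dρ` for all `r > 0` (a radial fixed point of the Thales average) is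
`h(r) = c r²` on `(0, ∞)`: the indicial root `α = 2` (the energy invariant `‖v‖²`) is the only
radial mode, and no growth condition is needed. [folklore] -/
theorem exists_eq_mul_sq_of_energyVolterra {h : ℝ → ℝ} (hh : Continuous h)
    (hfix : ∀ r, 0 < r → r ^ 2 * h r = 4 * ∫ ρ in (0 : ℝ)..r, ρ * h ρ) :
    ∃ c : ℝ, ∀ r, 0 < r → h r = c * r ^ 2 := by
  obtain ⟨c, hc⟩ := exists_abs_sub_mul_sq_le_of_energyVolterra (f := fun _ => 0) (b := 0) hh
    (fun r _ => by simp) (fun r hr => by rw [hfix r hr]; ring)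
  exact ⟨c, fun r hr => by
    have := hc r hr
    rw [mul_zero, abs_nonpos_iff, sub_eq_zero] at this
    exact this⟩

/-! ### The momentum sector `r³ h = 4 ∫₀^r ρ² h + r³ f` -/

/-- **Momentum sector of the Thales average, bounded inverse modulo `r`.** Let `h` be continuous
and let `f` be bounded by `b` on `(0, ∞)`. If `r³ h(r) = 4 ∫₀^r ρ² h(ρ) dρ + r³ f(r)` for all
`r > 0` (i.e. `h = T₁ h + f` for the dipole Thales average `T₁ h (r) = 4 ∫₀¹ h(r t) t² dt`), then
there is a constant `c` with `|h(r) - c r| ≤ 5 b` for all `r > 0`. Proof: `F = ∫₀^r ρ² h`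
satisfies `(F / r⁴)' = f / r²`, so `|F/r⁴ - c/4| ≤ b/r`, and `h = 4F/r³ + f`. [folklore] -/
theorem exists_abs_sub_mul_le_of_momentumVolterra {h f : ℝ → ℝ} {b : ℝ} (hh : Continuous h)
    (hb : ∀ r, 0 < r → |f r| ≤ b)
    (hfix : ∀ r, 0 < r → r ^ 3 * h r = 4 * (∫ ρ in (0 : ℝ)..r, ρ ^ 2 * h ρ) + r ^ 3 * f r) :
    ∃ c : ℝ, ∀ r, 0 < r → |h r - c * r| ≤ 5 * b := by
  set F : ℝ → ℝ := fun r => ∫ ρ in (0 : ℝ)..r, ρ ^ 2 * h ρ with hF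
  have hFd : ∀ r, HasDerivAt F (r ^ 2 * h r) r := fun r =>
    (((continuous_pow 2).mul hh).integral_hasStrictDerivAt 0 r).hasDerivAt
  have hFc : Continuous F := continuous_iff_continuousAt.2 fun r => (hFd r).continuousAt
  have hfeq : ∀ r, 0 < r → f r = h r - 4 * F r / r ^ 3 := by
    intro r hr
    have key := hfix r hr
    have hr3 : r ^ 3 ≠ 0 := pow_ne_zero 3 hr.ne'
    field_simp
    linarith
  have hfc : ContinuousOn f (Ioi 0) := by
    have : ContinuousOn (fun r => h r - 4 * F r / r ^ 3) (Ioi 0) :=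
      hh.continuousOn.sub ((continuousOn_const.mul hFc.continuousOn).div (continuousOn_pow 3)
        fun r hr => pow_ne_zero 3 (ne_of_gt hr))
    exact this.congr fun r hr => hfeq r hr
  set G : ℝ → ℝ := fun r => F r / r ^ 4 with hG
  have hGd : ∀ r, 0 < r → HasDerivAt G (f r / r ^ 2) r := by
    intro r hr
    have hr0 : r ≠ 0 := hr.ne'
    have e := (hFd r).div (hasDerivAt_pow 4 r) (pow_ne_zero 4 hr0)
    refine e.congr_deriv ?_
    have key := hfix r hr
    field_simp
    linear_combination (r ^ 3) * key
  have hgc : ContinuousOn (fun r => f r / r ^ 2) (Ioi 0) :=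
    hfc.div (continuousOn_pow 2) fun r hr => pow_ne_zero 2 (ne_of_gt hr)
  have hgb : ∀ r, 0 < r → |f r / r ^ 2| ≤ b * 1 * r ^ (-((1 : ℝ) + 1)) := by
    intro r hr
    rw [show (-((1 : ℝ) + 1)) = -((2 : ℕ) : ℝ) by norm_num, rpow_neg_natCast_eq_inv_pow r, abs_div,
      abs_of_pos (pow_pos hr 2), div_eq_mul_inv, mul_one]
    exact mul_le_mul_of_nonneg_right (hb r hr) (inv_nonneg.2 (pow_pos hr 2).le)
  obtain ⟨c', hc'⟩ := exists_abs_sub_le_of_hasDerivAt_Ioi one_pos hgc hGd hgb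
  refine ⟨4 * c', fun r hr => ?_⟩
  have hr0 : r ≠ 0 := hr.ne'
  have hGr := hc' r hr
  rw [show (-(1 : ℝ)) = -((1 : ℕ) : ℝ) by norm_num, rpow_neg_natCast_eq_inv_pow r, pow_one] at hGr
  have hdecomp : h r - 4 * c' * r = 4 * r * (G r - c') + f r := by
    rw [hfeq r hr, hG]
    field_simp
    ring
  rw [hdecomp]
  have h1 : |4 * r * (G r - c')| ≤ 4 * b := by
    rw [abs_mul, abs_of_pos (by positivity : (0 : ℝ) < 4 * r)]
    calc 4 * r * |G r - c'| ≤ 4 * r * (b * r⁻¹) := mul_le_mul_of_nonneg_left hGr (by positivity)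
      _ = 4 * b := by field_simp
  calc |4 * r * (G r - c') + f r| ≤ |4 * r * (G r - c')| + |f r| := abs_add_le _ _
    _ ≤ 4 * b + b := add_le_add h1 (hb r hr)
    _ = 5 * b := by ring

/-- **Liouville theorem in the momentum sector.** A continuous `h` with
`r³ h(r) = 4 ∫₀^r ρ² h(ρ) dρ` for all `r > 0` (a dipole fixed point of the Thales average) is
`h(r) = c r` on `(0, ∞)`: the indicial root `α = 1` (the momentum invariants `⟪e, v⟫`) is the
only dipole mode. [folklore] -/
theorem exists_eq_mul_of_momentumVolterra {h : ℝ → ℝ} (hh : Continuous h)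
    (hfix : ∀ r, 0 < r → r ^ 3 * h r = 4 * ∫ ρ in (0 : ℝ)..r, ρ ^ 2 * h ρ) :
    ∃ c : ℝ, ∀ r, 0 < r → h r = c * r := by
  obtain ⟨c, hc⟩ := exists_abs_sub_mul_le_of_momentumVolterra (f := fun _ => 0) (b := 0) hh
    (fun r _ => by simp) (fun r hr => by rw [hfix r hr]; ring)
  exact ⟨c, fun r hr => by
    have := hc r hr
    rw [mul_zero, abs_nonpos_iff, sub_eq_zero] at this
    exact this⟩

end Literature.Analysis.ODE
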